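import Mathlib
import HarnessLib
import Summits.HubbardSuperconductivity.HubbardSuperconductivity.Theorems.KLProgrammeKLRegimeSplitTwoLegSizesMSChainStep
import Summits.HubbardSuperconductivity.HubbardSuperconductivity.Theorems.KLProgrammePerturbedFermiCurveTwoFrameGradedArith2
import Summits.HubbardSuperconductivity.HubbardSuperconductivity.Theorems.KLProgrammePerturbedFermiCurveTwoFrameGradedArith3
import Summits.HubbardSuperconductivity.HubbardSuperconductivity.Theorems.KLProgrammePerturbedFermiCurveNumerics

/-!
# Route `KLProgramme`, crux K3 — ENGINE child (stmt-…-19918 → gen-6 `KLRegimeEngineV15`, `stub_twoLeg_step` / `stub_twoLeg_scale0`,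
# clause (E3a-MS)): CLOSED-FORM MAJORANTS OF THE CHAIN-STEP CONSTANTS `msW0 … msW4`, `msdD` WITH THE FRAME SIZES `A₃, A₄` SYMBOLIC

Cell `gate-hubbard-kl`, seat hubbard-kl-k3c3-p3 (g4) «implicit-function / monotonicity route for μ(n)»; MS-A34 (evidence #42 on 19918):
the fit hypotheses of the (E3a-MS) supplier theorems must be priced with SLOT-DEPENDENT third/fourth frame sizes, for which the
normalisation `A₃ ≤ λ` of the graded₂ numerals fails; so the step constants of `…TwoLegSizesMSChainStep` (k3c3-p1) are majorised here by
polynomials in `(η, λ, e₀, A₃, A₄)` under the graded hypotheses `e 0 ≤ e₀`, `2ʲ·e j ≤ η·λʲ` (`1 ≤ j ≤ 4`), `A ≤ 1/20`,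
`klCurveD ≤ Dt − 2A`, `A₃, A₄ ≥ 0`:
`msW0 ≤ 7e₀`, `msW1 ≤ 703ηλ + 18100e₀` (`graded2_aux_one`), `msW2/3/4 ≤ …` (`ms3_aux_two/three/four`), and the curve-tower differences
`msdD … i ≤ dD_i` (`msdD_le_*`).  Pure real inequalities on k3c3-p1's definitions; everything PROVED; no definitions, no named facts. [folklore]
-/

noncomputable section

namespace Summit.HubbardSuperconductivity.HubbardSuperconductivity.Theorems.KLRegimeSplit

set_option linter.dupNamespace false -- summit = problem name (single-conjunct summit), D-0017

open Real Summit.HubbardSuperconductivity.HubbardSuperconductivity.Theorems.PerturbedFermiCurve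

section Step

variable {A A₃ A₄ Dt : ℝ} {e : ℕ → ℝ} {η e₀ l : ℝ}
  (hA0 : 0 ≤ A) (hA20 : A ≤ 1 / 20) (hd : klCurveD ≤ Dt - 2 * A) (hA₃ : 0 ≤ A₃) (hA₄ : 0 ≤ A₄)
  (he : ∀ j, 0 ≤ e j) (hη : 0 ≤ η) (he₀ : 0 ≤ e₀) (hl : 1 ≤ l)
  (hE0 : e 0 ≤ e₀) (hE1 : 2 * e 1 ≤ η * l) (hE2 : 4 * e 2 ≤ η * l ^ 2) (hE3 : 8 * e 3 ≤ η * l ^ 3) (hE4 : 16 * e 4 ≤ η * l ^ 4)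

include hd in
/-- The transversality room of the chain: `33/200 ≤ Dt − 2A`. -/
theorem msRho_ge : (33 : ℝ) / 200 ≤ Dt - 2 * A := klCurveD_ge.trans hd

include hd in
/-- `0 < Dt − 2A`. -/
theorem msRho_pos : 0 < Dt - 2 * A := lt_of_lt_of_le (by norm_num) (msRho_ge hd)

include hd he in
/-- `0 ≤ msW0`. -/
theorem msW0_nonneg : 0 ≤ msW0 A Dt e := by
  have := msRho_pos hd; have := he 0; unfold msW0; positivity

include hd he₀ hE0 in
/-- **`msW0 ≤ 7·e₀`.** -/
theorem msW0_le : msW0 A Dt e ≤ 7 * e₀ := by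
  have hρ := msRho_ge hd; have hρ0 := msRho_pos hd
  unfold msW0; rw [div_le_iff₀ hρ0]; nlinarith

include hA0 hd he in
/-- `0 ≤ msW1`. -/
theorem msW1_nonneg : 0 ≤ msW1 A Dt e := by
  have := msRho_pos hd; have := he 0; have := he 1; have := pi_mul_sqrt_two_nonneg; unfold msW1; positivity

include hA0 hA20 hd he hη he₀ hl hE0 hE1 in
/-- **`msW1 ≤ 703·ηλ + 18100·e₀`** (`graded2_aux_one`). -/
theorem msW1_le : msW1 A Dt e ≤ 703 * η * l + 18100 * e₀ := by
  have h1 : 0 ≤ 2 * e 1 := by have := he 1; positivity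
  unfold msW1
  exact graded2_aux_one (msRho_ge hd) hA0 hA20 pi_mul_sqrt_two_nonneg pi_mul_sqrt_two_le hη he₀ hl (he 0) hE0 h1 hE1

include hA0 hA₃ hd he in
/-- `0 ≤ msW2`. -/
theorem msW2_nonneg : 0 ≤ msW2 A A₃ Dt e := by
  have := msRho_pos hd; have := he 0; have := he 1; have := he 2; have := pi_mul_sqrt_two_nonneg
  have := klCurveR1_nonneg; have := klCurveR2_nonneg; have := msW1_nonneg hA0 hd he
  unfold msW2; positivity

include hA0 hA20 hd hA₃ he hη he₀ hl hE0 hE1 hE2 in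
/-- **`msW2 ≤ B2`** (`ms3_aux_two`). -/
theorem msW2_le : msW2 A A₃ Dt e ≤ 6370000 * η * l ^ 2 + 164000000 * e₀ + 3920000 * e₀ * A₃ := by
  have h1 : 0 ≤ 2 * e 1 := by have := he 1; positivity
  unfold msW2
  exact ms3_aux_two (msRho_ge hd) hA0 hA20 pi_mul_sqrt_two_nonneg pi_mul_sqrt_two_le klCurveR1_nonneg klCurveR1_le klCurveR2_le
    hη he₀ hl hA₃ (he 0) hE0 h1 hE1 hE2 (msW1_nonneg hA0 hd he) (msW1_le hA0 hA20 hd he hη he₀ hl hE0 hE1)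

include hA0 hA₃ hA₄ hd he in
/-- `0 ≤ msW3`. -/
theorem msW3_nonneg : 0 ≤ msW3 A A₃ A₄ Dt e := by
  have := msRho_pos hd; have := he 0; have := he 1; have := he 2; have := he 3; have := pi_mul_sqrt_two_nonneg
  have := klCurveR1_nonneg; have := klCurveR2_nonneg; have := klCurveT3_nonneg hA₃
  have := msW1_nonneg hA0 hd he; have := msW2_nonneg hA0 hd hA₃ he
  unfold msW3; positivity

set_option maxHeartbeats 400000 in
include hA0 hA20 hd hA₃ hA₄ he hη he₀ hl hE0 hE1 hE2 hE3 in
/-- **`msW3 ≤ B3`** (`ms3_aux_three`). -/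
theorem msW3_le : msW3 A A₃ A₄ Dt e ≤
    96300000000 * η * l ^ 3 + 1830000000 * η * l * A₃ + 2480000000000 * e₀ + 905000000 * e₀ * A₄ + 118000000000 * e₀ * A₃ := by
  have h1 : 0 ≤ 2 * e 1 := by have := he 1; positivity
  unfold msW3
  exact ms3_aux_three (msRho_ge hd) hA0 hA20 pi_mul_sqrt_two_nonneg pi_mul_sqrt_two_le klCurveR1_nonneg klCurveR1_le
    klCurveR2_nonneg klCurveR2_le (klCurveT3_le hA₃) hη he₀ hl hA₃ hA₄ (he 0) hE0 h1 hE1 hE2 hE3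
    (msW1_nonneg hA0 hd he) (msW1_le hA0 hA20 hd he hη he₀ hl hE0 hE1)
    (msW2_nonneg hA0 hd hA₃ he) (msW2_le hA0 hA20 hd hA₃ he hη he₀ hl hE0 hE1 hE2)

include hA0 hA₃ hA₄ hd he in
/-- `0 ≤ msW4`. -/
theorem msW4_nonneg : 0 ≤ msW4 A A₃ A₄ Dt e := by
  have := msRho_pos hd; have := he 0; have := he 1; have := he 2; have := he 3; have := he 4; have := pi_mul_sqrt_two_nonneg
  have := klCurveR1_nonneg; have := klCurveR2_nonneg; have := klCurveT3_nonneg hA₃; have := klCurveT4_nonneg hA₃ hA₄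
  have := msW1_nonneg hA0 hd he; have := msW2_nonneg hA0 hd hA₃ he; have := msW3_nonneg hA0 hd hA₃ hA₄ he
  unfold msW4; positivity

set_option maxHeartbeats 400000 in
include hA0 hA20 hd hA₃ hA₄ he hη he₀ hl hE0 hE1 hE2 hE3 hE4 in
/-- **`msW4 ≤ B4`** (`ms3_aux_four`; the e-free term `3.45·10¹⁰·A₄` is the non-Lipschitz fourth-derivative transport). -/
theorem msW4_le : msW4 A A₃ A₄ Dt e ≤
    34500000000 * A₄ + 2040000000000000 * η * l ^ 4 + 529000000000 * η * l * A₄ + 82500000000000 * η * l ^ 2 * A₃ + 52500000000000000 * e₀ + 40800000000000 * e₀ * A₄ + 3720000000000000 * e₀ * A₃ + 25600000000000 * e₀ * A₃ ^ 2 := by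
  have h1 : 0 ≤ 2 * e 1 := by have := he 1; positivity
  unfold msW4
  exact ms3_aux_four (msRho_ge hd) hA0 hA20 pi_mul_sqrt_two_nonneg pi_mul_sqrt_two_le klCurveR1_nonneg klCurveR1_le
    klCurveR2_nonneg klCurveR2_le (klCurveT3_nonneg hA₃) (klCurveT3_le hA₃) (klCurveT4_le hA₃ hA₄) hη he₀ hl hA₃ hA₄ (he 0) hE0 h1
    hE1 hE2 hE3 hE4
    (msW1_nonneg hA0 hd he) (msW1_le hA0 hA20 hd he hη he₀ hl hE0 hE1)
    (msW2_nonneg hA0 hd hA₃ he) (msW2_le hA0 hA20 hd hA₃ he hη he₀ hl hE0 hE1 hE2)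
    (msW3_nonneg hA0 hd hA₃ hA₄ he) (msW3_le hA0 hA20 hd hA₃ hA₄ he hη he₀ hl hE0 hE1 hE2 hE3)

include hA0 hA₃ hA₄ hd he in
/-- `0 ≤ msdD … i` for every `i`. -/
theorem msdD_nonneg (i : ℕ) : 0 ≤ msdD A A₃ A₄ Dt e i := by
  have := msW0_nonneg hd he; have := msW1_nonneg hA0 hd he; have := msW2_nonneg hA0 hd hA₃ he
  have := msW3_nonneg hA0 hd hA₃ hA₄ he; have := msW4_nonneg hA0 hd hA₃ hA₄ he
  rcases i with _ | _ | _ | _ | _ <;> simp only [msdD] <;> positivity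

include hd he₀ hE0 in
/-- **`msdD … 0 ≤ dD₀ = 7e₀`** (the Fermi-point distance). -/
theorem msdD_le_zero : msdD A A₃ A₄ Dt e 0 ≤ 7 * e₀ := by
  simp only [msdD]; exact msW0_le hd he₀ hE0

include hA0 hA20 hd he hη he₀ hl hE0 hE1 in
/-- **`msdD … 1 ≤ dD₁`.** -/
theorem msdD_le_one : msdD A A₃ A₄ Dt e 1 ≤ 1410 * η * l + 36300 * e₀ := by
  simp only [msdD]
  have hl0 : 0 ≤ l := by linarith
  have p1 : 0 ≤ η * l := by positivity
  linarith [msW0_le hd he₀ hE0, msW1_le hA0 hA20 hd he hη he₀ hl hE0 hE1]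

include hA0 hA20 hd hA₃ he hη he₀ hl hE0 hE1 hE2 in
/-- **`msdD … 2 ≤ dD₂`.** -/
theorem msdD_le_two : msdD A A₃ A₄ Dt e 2 ≤ 12800000 * η * l ^ 2 + 329000000 * e₀ + 7840000 * e₀ * A₃ := by
  simp only [msdD]
  have hl0 : 0 ≤ l := by linarith
  have p1 : 0 ≤ η * l ^ 2 := by positivity
  have p2 : 0 ≤ e₀ * A₃ := by positivity
  have d1 : η * l ≤ η * l ^ 2 := by simpa using graded_mono hη hl (show 1 ≤ 2 by norm_num)
  linarith [msW0_le hd he₀ hE0, msW1_le hA0 hA20 hd he hη he₀ hl hE0 hE1, msW2_le hA0 hA20 hd hA₃ he hη he₀ hl hE0 hE1 hE2]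

include hA0 hA20 hd hA₃ hA₄ he hη he₀ hl hE0 hE1 hE2 hE3 in
/-- **`msdD … 3 ≤ dD₃`.** -/
theorem msdD_le_three : msdD A A₃ A₄ Dt e 3 ≤
    193000000000 * η * l ^ 3 + 3660000000 * η * l * A₃ + 4970000000000 * e₀ + 1810000000 * e₀ * A₄ + 237000000000 * e₀ * A₃ := by
  simp only [msdD]
  have hl0 : 0 ≤ l := by linarith
  have p1 : 0 ≤ η * l ^ 3 := by positivity
  have p2 : 0 ≤ η * l * A₃ := by positivity
  have p3 : 0 ≤ e₀ * A₃ := by positivity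
  have p4 : 0 ≤ e₀ * A₄ := by positivity
  have d1 : η * l ≤ η * l ^ 3 := by simpa using graded_mono hη hl (show 1 ≤ 3 by norm_num)
  have d2 : η * l ^ 2 ≤ η * l ^ 3 := by simpa using graded_mono hη hl (show 2 ≤ 3 by norm_num)
  linarith [msW0_le hd he₀ hE0, msW1_le hA0 hA20 hd he hη he₀ hl hE0 hE1, msW2_le hA0 hA20 hd hA₃ he hη he₀ hl hE0 hE1 hE2,
    msW3_le hA0 hA20 hd hA₃ hA₄ he hη he₀ hl hE0 hE1 hE2 hE3]

include hA0 hA20 hd hA₃ hA₄ he hη he₀ hl hE0 hE1 hE2 hE3 hE4 in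
/-- **`msdD … 4 ≤ dD₄`.** -/
theorem msdD_le_four : msdD A A₃ A₄ Dt e 4 ≤
    69000000000 * A₄ + 4090000000000000 * η * l ^ 4 + 1060000000000 * η * l * A₄ + 166000000000000 * η * l ^ 2 * A₃ + 106000000000000000 * e₀ + 81700000000000 * e₀ * A₄ + 7450000000000000 * e₀ * A₃ + 51200000000000 * e₀ * A₃ ^ 2 := by
  simp only [msdD]
  have d1 : η * l ≤ η * l ^ 4 := by simpa using graded_mono hη hl (show 1 ≤ 4 by norm_num)
  have d2 : η * l ^ 2 ≤ η * l ^ 4 := by simpa using graded_mono hη hl (show 2 ≤ 4 by norm_num)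
  have d3 : η * l ^ 3 ≤ η * l ^ 4 := by simpa using graded_mono hη hl (show 3 ≤ 4 by norm_num)
  have d4 : η * l * A₃ ≤ η * l ^ 2 * A₃ := by
    have h0 : η * l ^ 1 ≤ η * l ^ 2 := graded_mono hη hl (by norm_num)
    have := mul_le_mul_of_nonneg_right h0 hA₃
    simpa [mul_assoc] using this
  have hl0 : 0 ≤ l := by linarith
  have p1 : 0 ≤ η * l ^ 4 := by positivity
  have p2 : 0 ≤ η * l ^ 2 * A₃ := by positivity
  have p3 : 0 ≤ η * l * A₄ := by positivity
  have p4 : 0 ≤ e₀ * A₃ := by positivity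
  have p5 : 0 ≤ e₀ * A₄ := by positivity
  have p6 : 0 ≤ e₀ * A₃ ^ 2 := by positivity
  have p7 : 0 ≤ A₄ := hA₄
  linarith [msW0_le hd he₀ hE0, msW1_le hA0 hA20 hd he hη he₀ hl hE0 hE1, msW2_le hA0 hA20 hd hA₃ he hη he₀ hl hE0 hE1 hE2,
    msW3_le hA0 hA20 hd hA₃ hA₄ he hη he₀ hl hE0 hE1 hE2 hE3, msW4_le hA0 hA20 hd hA₃ hA₄ he hη he₀ hl hE0 hE1 hE2 hE3 hE4]

end Step

end Summit.HubbardSuperconductivity.HubbardSuperconductivity.Theorems.KLRegimeSplit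

end
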